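import Literature.NumberTheory.Rogawski1990.LocalTransferFundamentalLemma
import Literature.NumberTheory.Automorphic.LocalOrbitalMeasureRegular
import Literature.NumberTheory.Rogawski1990.LocalTransferTransportMeasure
import HarnessLib

/-!
# INHABITANTS of the admissibility pins: orbital measure families on `U(H)(L⁺_v)` and on `U(Φ₂)(L⁺_v) × U(Φ₁)(L⁺_v)` that are
# `IsAdmissibleOn` the regular (resp. `G`-regular) classes

Topic `NumberTheory/Rogawski1990`; namespace `Literature.NumberTheory.Rogawski1990`.  PROOF FILE (kernel lane): theorems only, no definition, no named
fact, no `sorry`.  The three-line folds announced on the F0P3a bus (p02 (g0) 01:15Z ∕ A-p06 (g18)): ★ `UnitaryGroup.exists_localOrbitalMeasureFamily_of_three_le`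
∕ `…_antidiagOne` ∕ `…_endoscopic` (`Automorphic/LocalOrbitalMeasureRegular`, F0P3a-p02: at every class with REGULAR representative a non-zero invariant
regular measure on the orbit quotient, from the unimodularity of the local unitary groups and the commutativity of regular centralisers) packaged as
★ `OrbitalMeasureFamily.IsAdmissibleOn` (`Rogawski1990/LocalTransferFundamentalLemma`, A-p06) through ★ `exists_isAdmissibleOn_of_forall`.  Two dresses:
with the measurable structures as instance HYPOTHESES (any Borel structures), and with the σ-algebras FIXED to `borel` exactly as inside the named facts
`LocalEndoscopicTransfer` ∕ `LocalTransferWithFundamentalLemma` — so the admissibility conjuncts of those facts (and of the engine line's pin (vi′)) are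
INHABITED in the tree; only the transfer-existence conjunct is posited.  Plus the TRANSPORT corollary F0P3a-p03 (g0) handed over (01:18Z):
`OrbitalMeasureFamily.IsAdmissibleOn.transport` — admissibility on a class of elements is carried along a bicontinuous group isomorphism `ψ : B ≃* A` by the
transported family ★ `OrbitalMeasureFamily.transport` (`LocalTransferTransport`, p03) with its member-wise lemmas ★ `transport_ne_zero` ∕
`smulInvariantMeasure_transport` ∕ `isFiniteMeasureOnCompacts_transport` (`LocalTransferTransportMeasure`, p03), for predicates `Q` on `B` that are CLASS
FUNCTIONS and implied by `P` through `ψ⁻¹` (the representative of the pre-image class is only CONJUGATE to `ψ⁻¹ (out c)`).  [Rogawski1990, §4.9 p. 54 (the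
measures `dg∕dg_γ` of the orbital integrals); §14.2 (14.2.1) p. 232 (regular semisimple classes)]; [DeitmarEchterhoff2014, Thm. 1.5.3]; [Gelbart1975, §10].
HC_CM is proved only modulo the printed citations until rung 0 closes.
-/

noncomputable section

open MeasureTheory NumberField IsDedekindDomain
open scoped Matrix

namespace Literature.NumberTheory.Rogawski1990

open Literature.NumberTheory.Automorphic

section AnyBorel

variable (L : Type) [Field L] [NumberField L] [IsCMField L] {N : ℕ}

/-- **`G′_v = U(H)(L⁺_v)`, `N ≥ 3`, `H` hermitian non-degenerate: an orbital measure family ADMISSIBLE ON THE REGULAR CLASSES exists** (any Borel structures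
on the orbit quotients; ★ `exists_localOrbitalMeasureFamily_of_three_le`). [cite: Rogawski1990, §4.9 p. 54; §14.2 (14.2.1) p. 232] [cite: DeitmarEchterhoff2014, Thm. 1.5.3] -/
theorem exists_isAdmissibleOn_isRegularElt_of_three_le (hN : 3 ≤ N) (H : Matrix (Fin N) (Fin N) L)
    (hH : (H.map (cmConjRingHom L))ᵀ = H) (hdet : H.det ≠ 0) (v : HeightOneSpectrum (𝓞 ↥(maximalRealSubfield L)))
    [MeasurableSpace ((UnitaryGroup.cmDatum L N H).Local v)] [BorelSpace ((UnitaryGroup.cmDatum L N H).Local v)]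
    [∀ γ : (UnitaryGroup.cmDatum L N H).Local v,
      MeasurableSpace (((UnitaryGroup.cmDatum L N H).Local v) ⧸ Subgroup.centralizer ({γ} : Set ((UnitaryGroup.cmDatum L N H).Local v)))]
    [∀ γ : (UnitaryGroup.cmDatum L N H).Local v,
      BorelSpace (((UnitaryGroup.cmDatum L N H).Local v) ⧸ Subgroup.centralizer ({γ} : Set ((UnitaryGroup.cmDatum L N H).Local v)))] :
    ∃ m : OrbitalMeasureFamily ((UnitaryGroup.cmDatum L N H).Local v),
      m.IsAdmissibleOn fun γ => IsRegularElt (γ.val : GL (Fin N) (UnitaryGroup.LocalRing L v)) := by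
  obtain ⟨m, hm⟩ := UnitaryGroup.exists_localOrbitalMeasureFamily_of_three_le L hN H hH hdet v
  exact ⟨m, fun c hc => ⟨(hm c hc).1, (hm c hc).2.1, (hm c hc).2.2.2⟩⟩

/-- **`G_v = U(Φ_N)(L⁺_v)`** (quasi-split form `antidiag(1, …, 1)`, any `N`): an orbital measure family admissible on the regular classes exists
(★ `exists_localOrbitalMeasureFamily_antidiagOne`). [cite: Rogawski1990, §4.9 p. 54; §14.2 (14.2.1) p. 232] [cite: DeitmarEchterhoff2014, Thm. 1.5.3] -/
theorem exists_isAdmissibleOn_isRegularElt_antidiagOne (N : ℕ) (v : HeightOneSpectrum (𝓞 ↥(maximalRealSubfield L)))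
    [MeasurableSpace ((UnitaryGroup.cmDatum L N (Matrix.of fun i j : Fin N => if i.val + j.val + 1 = N then (1 : L) else 0)).Local v)]
    [BorelSpace ((UnitaryGroup.cmDatum L N (Matrix.of fun i j : Fin N => if i.val + j.val + 1 = N then (1 : L) else 0)).Local v)]
    [∀ γ : (UnitaryGroup.cmDatum L N (Matrix.of fun i j : Fin N => if i.val + j.val + 1 = N then (1 : L) else 0)).Local v,
      MeasurableSpace (((UnitaryGroup.cmDatum L N (Matrix.of fun i j : Fin N => if i.val + j.val + 1 = N then (1 : L) else 0)).Local v) ⧸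
        Subgroup.centralizer ({γ} : Set ((UnitaryGroup.cmDatum L N (Matrix.of fun i j : Fin N => if i.val + j.val + 1 = N then (1 : L) else 0)).Local v)))]
    [∀ γ : (UnitaryGroup.cmDatum L N (Matrix.of fun i j : Fin N => if i.val + j.val + 1 = N then (1 : L) else 0)).Local v,
      BorelSpace (((UnitaryGroup.cmDatum L N (Matrix.of fun i j : Fin N => if i.val + j.val + 1 = N then (1 : L) else 0)).Local v) ⧸
        Subgroup.centralizer ({γ} : Set ((UnitaryGroup.cmDatum L N (Matrix.of fun i j : Fin N => if i.val + j.val + 1 = N then (1 : L) else 0)).Local v)))] :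
    ∃ m : OrbitalMeasureFamily ((UnitaryGroup.cmDatum L N (Matrix.of fun i j : Fin N => if i.val + j.val + 1 = N then (1 : L) else 0)).Local v),
      m.IsAdmissibleOn fun γ => IsRegularElt (γ.val : GL (Fin N) (UnitaryGroup.LocalRing L v)) := by
  obtain ⟨m, hm⟩ := UnitaryGroup.exists_localOrbitalMeasureFamily_antidiagOne L N v
  exact ⟨m, fun c hc => ⟨(hm c hc).1, (hm c hc).2.1, (hm c hc).2.2.2⟩⟩

/-- **`H_v = U(Φ₂)(L⁺_v) × U(Φ₁)(L⁺_v)`**: an orbital measure family admissible on the `G`-REGULAR classes exists (★ `exists_localOrbitalMeasureFamily_endoscopic`).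
[cite: Rogawski1990, §4.9 p. 54; §4.3 p. 42] [cite: DeitmarEchterhoff2014, Thm. 1.5.3] -/
theorem exists_isAdmissibleOn_isLocalGRegular (v : HeightOneSpectrum (𝓞 ↥(maximalRealSubfield L)))
    [MeasurableSpace ((UnitaryGroup.cmDatum L 2 (Matrix.of fun i j : Fin 2 => if i.val + j.val + 1 = 2 then (1 : L) else 0)).Local v ×
      (UnitaryGroup.cmDatum L 1 (Matrix.of fun i j : Fin 1 => if i.val + j.val + 1 = 1 then (1 : L) else 0)).Local v)]
    [BorelSpace ((UnitaryGroup.cmDatum L 2 (Matrix.of fun i j : Fin 2 => if i.val + j.val + 1 = 2 then (1 : L) else 0)).Local v ×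
      (UnitaryGroup.cmDatum L 1 (Matrix.of fun i j : Fin 1 => if i.val + j.val + 1 = 1 then (1 : L) else 0)).Local v)]
    [∀ a : ((UnitaryGroup.cmDatum L 2 (Matrix.of fun i j : Fin 2 => if i.val + j.val + 1 = 2 then (1 : L) else 0)).Local v ×
      (UnitaryGroup.cmDatum L 1 (Matrix.of fun i j : Fin 1 => if i.val + j.val + 1 = 1 then (1 : L) else 0)).Local v),
      MeasurableSpace (((UnitaryGroup.cmDatum L 2 (Matrix.of fun i j : Fin 2 => if i.val + j.val + 1 = 2 then (1 : L) else 0)).Local v ×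
        (UnitaryGroup.cmDatum L 1 (Matrix.of fun i j : Fin 1 => if i.val + j.val + 1 = 1 then (1 : L) else 0)).Local v) ⧸
        Subgroup.centralizer ({a} : Set ((UnitaryGroup.cmDatum L 2 (Matrix.of fun i j : Fin 2 => if i.val + j.val + 1 = 2 then (1 : L) else 0)).Local v ×
          (UnitaryGroup.cmDatum L 1 (Matrix.of fun i j : Fin 1 => if i.val + j.val + 1 = 1 then (1 : L) else 0)).Local v)))]
    [∀ a : ((UnitaryGroup.cmDatum L 2 (Matrix.of fun i j : Fin 2 => if i.val + j.val + 1 = 2 then (1 : L) else 0)).Local v ×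
      (UnitaryGroup.cmDatum L 1 (Matrix.of fun i j : Fin 1 => if i.val + j.val + 1 = 1 then (1 : L) else 0)).Local v),
      BorelSpace (((UnitaryGroup.cmDatum L 2 (Matrix.of fun i j : Fin 2 => if i.val + j.val + 1 = 2 then (1 : L) else 0)).Local v ×
        (UnitaryGroup.cmDatum L 1 (Matrix.of fun i j : Fin 1 => if i.val + j.val + 1 = 1 then (1 : L) else 0)).Local v) ⧸
        Subgroup.centralizer ({a} : Set ((UnitaryGroup.cmDatum L 2 (Matrix.of fun i j : Fin 2 => if i.val + j.val + 1 = 2 then (1 : L) else 0)).Local v ×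
          (UnitaryGroup.cmDatum L 1 (Matrix.of fun i j : Fin 1 => if i.val + j.val + 1 = 1 then (1 : L) else 0)).Local v)))] :
    ∃ mH : OrbitalMeasureFamily ((UnitaryGroup.cmDatum L 2 (Matrix.of fun i j : Fin 2 => if i.val + j.val + 1 = 2 then (1 : L) else 0)).Local v ×
      (UnitaryGroup.cmDatum L 1 (Matrix.of fun i j : Fin 1 => if i.val + j.val + 1 = 1 then (1 : L) else 0)).Local v),
      mH.IsAdmissibleOn (IsLocalGRegular L v) := by
  obtain ⟨m, hm⟩ := UnitaryGroup.exists_localOrbitalMeasureFamily_endoscopic L v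
  exact ⟨m, fun c hc => ⟨(hm c hc).1, (hm c hc).2.1, (hm c hc).2.2.2⟩⟩

end AnyBorel

/-! ## Transport of admissibility along a group isomorphism (p03's L6b′ lemmas, packaged) -/

section Transport

variable {A B : Type*} [Group A] [Group B] [TopologicalSpace A] [TopologicalSpace B] [IsTopologicalGroup A]
  [∀ a : A, MeasurableSpace (A ⧸ Subgroup.centralizer ({a} : Set A))] [∀ a : A, BorelSpace (A ⧸ Subgroup.centralizer ({a} : Set A))]
  [∀ b : B, MeasurableSpace (B ⧸ Subgroup.centralizer ({b} : Set B))] [∀ b : B, BorelSpace (B ⧸ Subgroup.centralizer ({b} : Set B))]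

/-- **Admissibility transports along a bicontinuous isomorphism `ψ : B ≃* A`**: if `m′` is admissible on the `B`-classes whose representative satisfies
`Q`, `Q` is a CLASS FUNCTION, and `P a → Q (ψ⁻¹ a)`, then `ψ_* m′` (★ `OrbitalMeasureFamily.transport`) is admissible on the `A`-classes whose representative
satisfies `P` — member-wise ★ `transport_ne_zero`, ★ `smulInvariantMeasure_transport`, ★ `isFiniteMeasureOnCompacts_transport`; the pre-image class's
representative is conjugate to `ψ⁻¹ (out c)` (★ `isConj_out_preClass`), whence the class-function hypothesis. [cite: Gelbart1975, §10 pp. 154–155]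
[cite: Rogawski1990, §14.2 (14.2.1) p. 232] -/
theorem _root_.Literature.NumberTheory.Automorphic.OrbitalMeasureFamily.IsAdmissibleOn.transport (ψ : B ≃* A) (hψ : Continuous ψ)
    (hψs : Continuous ψ.symm) {m' : OrbitalMeasureFamily B} {Q : B → Prop} (hm : m'.IsAdmissibleOn Q)
    (hQ : ∀ b b' : B, IsConj b b' → (Q b ↔ Q b')) {P : A → Prop} (hPQ : ∀ a : A, P a → Q (ψ.symm a)) :
    (m'.transport ψ hψ hψs).IsAdmissibleOn P := by
  intro c hc
  have hq : Q (Quotient.out (preClass ψ c) : B) := (hQ _ _ (isConj_out_preClass ψ c)).mpr (hPQ _ hc)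
  obtain ⟨hne, hinv, hfin⟩ := hm (preClass ψ c) hq
  haveI := hinv
  haveI := hfin
  exact ⟨transport_ne_zero ψ hψ hψs m' c hne, smulInvariantMeasure_transport ψ hψ hψs m' c,
    isFiniteMeasureOnCompacts_transport ψ hψ hψs m' c⟩

end Transport

/-! ## The `borel` dress: σ-algebras fixed as inside `LocalEndoscopicTransfer` ∕ `LocalTransferWithFundamentalLemma` -/

section BorelDress

variable (L : Type) [Field L] [NumberField L] [IsCMField L]

/-- **The admissibility conjuncts of `LocalEndoscopicTransfer L H′ v` are inhabited** (`N = 3`, `H′` hermitian non-degenerate): with the Borel σ-algebras of the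
fact's body there exist `mH` admissible on the `G`-regular classes of `H_v` and `mG` admissible on the regular classes of `U(H′)(L⁺_v)`.  (Only the transfer
factor's existence with the transfer-existence clause is posited by the fact.) [cite: Rogawski1990, §4.9 p. 54; Prop. 4.9.1 (a) p. 55]
[cite: DeitmarEchterhoff2014, Thm. 1.5.3] -/
theorem exists_isAdmissibleOn_borel (H' : Matrix (Fin 3) (Fin 3) L) (hH : (H'.map (cmConjRingHom L))ᵀ = H') (hdet : H'.det ≠ 0)
    (v : HeightOneSpectrum (𝓞 ↥(maximalRealSubfield L))) :
    letI : ∀ a : ((UnitaryGroup.cmDatum L 2 (Matrix.of fun i j : Fin 2 => if i.val + j.val + 1 = 2 then (1 : L) else 0)).Local v ×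
        (UnitaryGroup.cmDatum L 1 (Matrix.of fun i j : Fin 1 => if i.val + j.val + 1 = 1 then (1 : L) else 0)).Local v),
        MeasurableSpace (((UnitaryGroup.cmDatum L 2 (Matrix.of fun i j : Fin 2 => if i.val + j.val + 1 = 2 then (1 : L) else 0)).Local v ×
          (UnitaryGroup.cmDatum L 1 (Matrix.of fun i j : Fin 1 => if i.val + j.val + 1 = 1 then (1 : L) else 0)).Local v) ⧸
          Subgroup.centralizer ({a} : Set ((UnitaryGroup.cmDatum L 2 (Matrix.of fun i j : Fin 2 => if i.val + j.val + 1 = 2 then (1 : L) else 0)).Local v ×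
            (UnitaryGroup.cmDatum L 1 (Matrix.of fun i j : Fin 1 => if i.val + j.val + 1 = 1 then (1 : L) else 0)).Local v))) :=
      fun _ => borel _
    letI : ∀ γ : (UnitaryGroup.cmDatum L 3 H').Local v,
        MeasurableSpace ((UnitaryGroup.cmDatum L 3 H').Local v ⧸ Subgroup.centralizer ({γ} : Set ((UnitaryGroup.cmDatum L 3 H').Local v))) :=
      fun _ => borel _
    (∃ mH : OrbitalMeasureFamily ((UnitaryGroup.cmDatum L 2 (Matrix.of fun i j : Fin 2 => if i.val + j.val + 1 = 2 then (1 : L) else 0)).Local v ×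
        (UnitaryGroup.cmDatum L 1 (Matrix.of fun i j : Fin 1 => if i.val + j.val + 1 = 1 then (1 : L) else 0)).Local v),
        mH.IsAdmissibleOn (IsLocalGRegular L v)) ∧
      ∃ mG : OrbitalMeasureFamily ((UnitaryGroup.cmDatum L 3 H').Local v),
        mG.IsAdmissibleOn fun γ => IsRegularElt (γ.val : GL (Fin 3) (UnitaryGroup.LocalRing L v)) := by
  letI : MeasurableSpace ((UnitaryGroup.cmDatum L 2 (Matrix.of fun i j : Fin 2 => if i.val + j.val + 1 = 2 then (1 : L) else 0)).Local v ×
      (UnitaryGroup.cmDatum L 1 (Matrix.of fun i j : Fin 1 => if i.val + j.val + 1 = 1 then (1 : L) else 0)).Local v) := borel _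
  haveI : BorelSpace ((UnitaryGroup.cmDatum L 2 (Matrix.of fun i j : Fin 2 => if i.val + j.val + 1 = 2 then (1 : L) else 0)).Local v ×
      (UnitaryGroup.cmDatum L 1 (Matrix.of fun i j : Fin 1 => if i.val + j.val + 1 = 1 then (1 : L) else 0)).Local v) := ⟨rfl⟩
  letI : MeasurableSpace ((UnitaryGroup.cmDatum L 3 H').Local v) := borel _
  haveI : BorelSpace ((UnitaryGroup.cmDatum L 3 H').Local v) := ⟨rfl⟩
  letI : ∀ a : ((UnitaryGroup.cmDatum L 2 (Matrix.of fun i j : Fin 2 => if i.val + j.val + 1 = 2 then (1 : L) else 0)).Local v ×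
      (UnitaryGroup.cmDatum L 1 (Matrix.of fun i j : Fin 1 => if i.val + j.val + 1 = 1 then (1 : L) else 0)).Local v),
      MeasurableSpace (((UnitaryGroup.cmDatum L 2 (Matrix.of fun i j : Fin 2 => if i.val + j.val + 1 = 2 then (1 : L) else 0)).Local v ×
        (UnitaryGroup.cmDatum L 1 (Matrix.of fun i j : Fin 1 => if i.val + j.val + 1 = 1 then (1 : L) else 0)).Local v) ⧸
        Subgroup.centralizer ({a} : Set ((UnitaryGroup.cmDatum L 2 (Matrix.of fun i j : Fin 2 => if i.val + j.val + 1 = 2 then (1 : L) else 0)).Local v ×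
          (UnitaryGroup.cmDatum L 1 (Matrix.of fun i j : Fin 1 => if i.val + j.val + 1 = 1 then (1 : L) else 0)).Local v))) :=
    fun _ => borel _
  haveI : ∀ a : ((UnitaryGroup.cmDatum L 2 (Matrix.of fun i j : Fin 2 => if i.val + j.val + 1 = 2 then (1 : L) else 0)).Local v ×
      (UnitaryGroup.cmDatum L 1 (Matrix.of fun i j : Fin 1 => if i.val + j.val + 1 = 1 then (1 : L) else 0)).Local v),
      BorelSpace (((UnitaryGroup.cmDatum L 2 (Matrix.of fun i j : Fin 2 => if i.val + j.val + 1 = 2 then (1 : L) else 0)).Local v ×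
        (UnitaryGroup.cmDatum L 1 (Matrix.of fun i j : Fin 1 => if i.val + j.val + 1 = 1 then (1 : L) else 0)).Local v) ⧸
        Subgroup.centralizer ({a} : Set ((UnitaryGroup.cmDatum L 2 (Matrix.of fun i j : Fin 2 => if i.val + j.val + 1 = 2 then (1 : L) else 0)).Local v ×
          (UnitaryGroup.cmDatum L 1 (Matrix.of fun i j : Fin 1 => if i.val + j.val + 1 = 1 then (1 : L) else 0)).Local v))) :=
    fun _ => ⟨rfl⟩
  letI : ∀ γ : (UnitaryGroup.cmDatum L 3 H').Local v,
      MeasurableSpace ((UnitaryGroup.cmDatum L 3 H').Local v ⧸ Subgroup.centralizer ({γ} : Set ((UnitaryGroup.cmDatum L 3 H').Local v))) :=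
    fun _ => borel _
  haveI : ∀ γ : (UnitaryGroup.cmDatum L 3 H').Local v,
      BorelSpace ((UnitaryGroup.cmDatum L 3 H').Local v ⧸ Subgroup.centralizer ({γ} : Set ((UnitaryGroup.cmDatum L 3 H').Local v))) :=
    fun _ => ⟨rfl⟩
  exact ⟨exists_isAdmissibleOn_isLocalGRegular L v, exists_isAdmissibleOn_isRegularElt_of_three_le L le_rfl H' hH hdet v⟩

end BorelDress

end Literature.NumberTheory.Rogawski1990

end
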